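import Mathlib.Analysis.SpecialFunctions.Pow.Real
import Mathlib.Analysis.SpecialFunctions.Sqrt
import Mathlib.Analysis.PSeries
import Mathlib.Topology.Algebra.InfiniteSum.Real
import HarnessLib

/-!
# QUANT lane (p4 gen 18): a NO-GO for pointwise `δ ≥ 2` from the known critical-volume inequalities — the witness sequence
# and its properties (lemmas; the theorem is assembled in `…QuantCritVolumeNoGo`)

builds on p205010 (kernel theorem, internal audit signed; external expert review pending) — NOT used in this file (pure real
analysis; no percolation object appears).

Write `a_n = P_{p_c}(|C| ≥ n)` for the critical volume tail of bond percolation on `ℤ^d`, `S_n = Σ_{k≤n} a_k = E_{p_c}[|C| ∧ n]`.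
What the tree knows about the sequence `(a_n)` ALONE is: `a` antitone, `a_1 = 1`, `a_n → 0` (p205010), `Σ a_n = ∞` (`χ(p_c) = ∞`),
the Aizenman–Barsky/Newman GENERATING-FUNCTION bound `γ·Σ_s (1−γ)^s a_{s+1} ≥ c_M √γ` (`0 < γ < 1`; tree
`magnetization_criticalProb_ge_sqrt`, "δ ≥ 2" in the sense of HvdH 2017 Cor 4.5 / Grimmett 1999 Prop (10.29)), and the Hutchcroft/
Dewan–Muirhead PRODUCT bound `a_n·S_n ≥ c_P` (tree `CritProduct…`, P4-MODULUS S87).  The POINTWISE mean-field bound `a_n ≥ c/√n` is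
not in print for `d ≥ 3` (HvdH 2017 §4.3 p. 54: "a little tricky … we need to resort to a generating function estimate").

THIS FILE and its sequel: these constraints do NOT imply it — for every `c_M ≤ 1/2`, `c_P ≤ 1`, `ε > 0` there is a sequence
with all the properties above and `a_n < ε/√n` for some `n` (`critVolume_pointwise_noGo`, sequel).  The witness is the
PLATEAU-THEN-DROP profile `a_k = 1 (k ≤ N)`, `= 4/√N′ (N < k ≤ N′)`, `= 4/√k (k > N′)`, `N ≍ 128/ε²`, `N′ ≍ 16N/ε²`; here:
`seqA_antitone`, `seqA_tendsto_zero`, `seqA_not_summable`, `gf_bound` (plateau down to `γ ≍ 1/N²`, far tail below), `product_bound`.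
Any pointwise proof of `δ ≥ 2` on `ℤ^d`, `d ≥ 3`, therefore needs an input excluding volume plateaus at `p_c` (a doubling estimate
`a_{2n} ≥ c·a_n`, or an upper bound on `E_{p_c}[|C| ∧ n]`); at `d = 2` the pointwise bound holds by the one-arm floor (P4-MODULUS S31/S88).

HONEST: an elementary counterexample at the level of sequences (new as typed; a barrier statement, not percolation).

## References
* M. Heydenreich, R. van der Hofstad (2017), §4.3, Cor. 4.5 [HeydenreichVanDerHofstad2017]; G. Grimmett, *Percolation* (1999),
  Prop. (10.29) [GrimmettPercolation1999]; V. Dewan, S. Muirhead, EJP 28 (2023), §1.2 [DewanMuirhead2023].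
-/

noncomputable section

namespace Summit.CriticalPhenomena.PercolationContinuityZ3.Theorems.CritVolumeNoGo

open Filter Topology Finset
/-! ### §1 Two elementary power bounds -/

/-- `(1−γ)^N ≤ 1/(1 + Nγ)` for `0 ≤ γ ≤ 1` (from `(1−γ)^N(1+γ)^N = (1−γ²)^N ≤ 1` and Bernoulli). -/
theorem one_sub_pow_le_inv (N : ℕ) {γ : ℝ} (h0 : 0 ≤ γ) (h1 : γ ≤ 1) :
    (1 - γ) ^ N ≤ 1 / (1 + N * γ) := by
  have hB : 1 + (N : ℝ) * γ ≤ (1 + γ) ^ N := one_add_mul_le_pow (by linarith) N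
  have hpos : 0 < 1 + (N : ℝ) * γ := by positivity
  rw [le_div_iff₀ hpos]
  calc (1 - γ) ^ N * (1 + N * γ) ≤ (1 - γ) ^ N * (1 + γ) ^ N :=
        mul_le_mul_of_nonneg_left hB (pow_nonneg (by linarith) N)
    _ = (1 - γ ^ 2) ^ N := by rw [← mul_pow]; ring
    _ ≤ 1 ^ N := pow_le_pow_left₀ (by nlinarith) (by nlinarith) N
    _ = 1 := one_pow N

/-- `1/2 ≤ (1−γ)^M` when `0 ≤ γ` and `Mγ ≤ 1/2` (Bernoulli). -/
theorem half_le_one_sub_pow (M : ℕ) {γ : ℝ} (h1 : γ ≤ 1) (hM : (M : ℝ) * γ ≤ 1 / 2) :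
    1 / 2 ≤ (1 - γ) ^ M := by
  have hB : 1 + (M : ℝ) * (-γ) ≤ (1 + -γ) ^ M := one_add_mul_le_pow (by linarith) M
  have : (1 : ℝ) + -γ = 1 - γ := by ring
  rw [this] at hB
  linarith
/-! ### §2 The witness sequence -/

/-! The plateau-then-drop profile is `a k = 1` up to `N`, then the constant `4/√N′` up to `N′`, then `4/√k`; to keep the
file free of definitions it enters every lemma as the shape hypothesis
`ha : ∀ k, a k = if k ≤ N then 1 else if k ≤ N' then 4/√N' else 4/√k`. -/

variable {N N' : ℕ} {a : ℕ → ℝ}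

/-- Shape: `a k = 1` for `k ≤ N`. -/
theorem seqA_of_le_N (ha : ∀ k, a k = if k ≤ N then 1 else if k ≤ N' then 4 / Real.sqrt N' else 4 / Real.sqrt k) {k : ℕ} (hk : k ≤ N) : a k = 1 := by
  rw [ha k, if_pos hk]

/-- Shape: `a k = 4/√N'` for `N < k ≤ N'`. -/
theorem seqA_of_mid (ha : ∀ k, a k = if k ≤ N then 1 else if k ≤ N' then 4 / Real.sqrt N' else 4 / Real.sqrt k) {k : ℕ} (hk : N < k) (hk' : k ≤ N') :
    a k = 4 / Real.sqrt N' := by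
  rw [ha k, if_neg (not_le.2 hk), if_pos hk']

/-- Shape: `a k = 4/√k` for `k > N'`. -/
theorem seqA_of_gt (ha : ∀ k, a k = if k ≤ N then 1 else if k ≤ N' then 4 / Real.sqrt N' else 4 / Real.sqrt k) {k : ℕ} (hNN' : N ≤ N') (hk : N' < k) :
    a k = 4 / Real.sqrt k := by
  rw [ha k, if_neg (not_le.2 (lt_of_le_of_lt hNN' hk)), if_neg (not_le.2 hk)]

/-- The plateau height is at most `1` once `N′ ≥ 16`. -/
theorem height_le_one (hN' : 16 ≤ N') : 4 / Real.sqrt N' ≤ 1 := by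
  have h16 : (16 : ℝ) ≤ N' := by exact_mod_cast hN'
  have hs : 4 ≤ Real.sqrt N' := by
    rw [show (4 : ℝ) = Real.sqrt 16 by rw [show (16 : ℝ) = 4 ^ 2 by norm_num, Real.sqrt_sq (by norm_num)]]
    exact Real.sqrt_le_sqrt h16
  rw [div_le_one (by linarith)]
  exact hs

/-- The witness is positive. -/
theorem seqA_pos (ha : ∀ k, a k = if k ≤ N then 1 else if k ≤ N' then 4 / Real.sqrt N' else 4 / Real.sqrt k) (hN' : 16 ≤ N') (k : ℕ) : 0 < a k := by
  rw [ha k]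
  split_ifs with h1 h2
  · exact one_pos
  · have : (0 : ℝ) < N' := by exact_mod_cast (show 0 < N' by omega)
    exact div_pos (by norm_num) (Real.sqrt_pos.2 this)
  · have : (0 : ℝ) < k := by exact_mod_cast (show 0 < k by omega)
    exact div_pos (by norm_num) (Real.sqrt_pos.2 this)

/-- The witness is at most `1`. -/
theorem seqA_le_one (ha : ∀ k, a k = if k ≤ N then 1 else if k ≤ N' then 4 / Real.sqrt N' else 4 / Real.sqrt k) (hN' : 16 ≤ N') (k : ℕ) : a k ≤ 1 := by
  rw [ha k]
  split_ifs with h1 h2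
  · exact le_rfl
  · exact height_le_one hN'
  · have hk : (N' : ℝ) ≤ k := by exact_mod_cast (show N' ≤ k by omega)
    have hN'0 : (0 : ℝ) < N' := by exact_mod_cast (show 0 < N' by omega)
    calc 4 / Real.sqrt k ≤ 4 / Real.sqrt N' :=
          div_le_div_of_nonneg_left (by norm_num) (Real.sqrt_pos.2 hN'0) (Real.sqrt_le_sqrt hk)
      _ ≤ 1 := height_le_one hN'

/-- Lower bound by the plateau height on `k ≤ N′`. -/
theorem height_le_seqA (ha : ∀ k, a k = if k ≤ N then 1 else if k ≤ N' then 4 / Real.sqrt N' else 4 / Real.sqrt k) (hN' : 16 ≤ N') {k : ℕ} (hk : k ≤ N') :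
    4 / Real.sqrt N' ≤ a k := by
  rw [ha k]
  split_ifs with h1
  · exact height_le_one hN'
  · exact le_rfl

/-- The sequence is antitone. -/
theorem seqA_antitone (ha : ∀ k, a k = if k ≤ N then 1 else if k ≤ N' then 4 / Real.sqrt N' else 4 / Real.sqrt k) (hN' : 16 ≤ N') (hNN' : N ≤ N') : Antitone a := by
  intro j k hjk
  by_cases hk : k ≤ N
  · rw [seqA_of_le_N ha hk, seqA_of_le_N ha (hjk.trans hk)]
  by_cases hk' : k ≤ N'
  · rw [seqA_of_mid ha (not_le.1 hk) hk']
    exact height_le_seqA ha hN' (hjk.trans hk')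
  · rw [seqA_of_gt ha hNN' (not_le.1 hk')]
    by_cases hj' : j ≤ N'
    · have hk2 : (N' : ℝ) ≤ k := by exact_mod_cast (not_le.1 hk').le
      have hN'0 : (0 : ℝ) < N' := by exact_mod_cast (show 0 < N' by omega)
      calc 4 / Real.sqrt k ≤ 4 / Real.sqrt N' :=
            div_le_div_of_nonneg_left (by norm_num) (Real.sqrt_pos.2 hN'0) (Real.sqrt_le_sqrt hk2)
        _ ≤ a j := height_le_seqA ha hN' hj'
    · rw [seqA_of_gt ha hNN' (not_le.1 hj')]
      have hj0 : (0 : ℝ) < j := by exact_mod_cast (show 0 < j by omega)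
      exact div_le_div_of_nonneg_left (by norm_num) (Real.sqrt_pos.2 hj0)
        (Real.sqrt_le_sqrt (by exact_mod_cast hjk))

/-- Far out the sequence is `4/√k`, which tends to `0`. -/
theorem seqA_tendsto_zero (ha : ∀ k, a k = if k ≤ N then 1 else if k ≤ N' then 4 / Real.sqrt N' else 4 / Real.sqrt k) (hNN' : N ≤ N') : Tendsto a atTop (𝓝 0) := by
  have hlim : Tendsto (fun k : ℕ => 4 / Real.sqrt k) atTop (𝓝 0) := by
    have h := (tendsto_const_nhds (x := (4 : ℝ))).div_atTop
      (Real.tendsto_sqrt_atTop.comp tendsto_natCast_atTop_atTop)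
    exact h
  refine hlim.congr' ?_
  filter_upwards [eventually_gt_atTop N'] with k hk
  exact (seqA_of_gt ha hNN' hk).symm

/-- The sequence is not summable (its tail dominates `1/k`). -/
theorem seqA_not_summable (ha : ∀ k, a k = if k ≤ N then 1 else if k ≤ N' then 4 / Real.sqrt N' else 4 / Real.sqrt k) (hNN' : N ≤ N') : ¬ Summable a := by
  intro hsum
  have hK : ∀ k : ℕ, (1 : ℝ) / ((k + (N' + 1) : ℕ) : ℝ) ≤ a (k + (N' + 1)) := by
    intro k
    have hk : N' < k + (N' + 1) := by omega
    rw [seqA_of_gt ha hNN' hk]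
    have hk1 : (1 : ℝ) ≤ ((k + (N' + 1) : ℕ) : ℝ) := by exact_mod_cast (show 1 ≤ k + (N' + 1) by omega)
    have hk0 : (0 : ℝ) < ((k + (N' + 1) : ℕ) : ℝ) := by linarith
    have hs : Real.sqrt ((k + (N' + 1) : ℕ) : ℝ) ≤ ((k + (N' + 1) : ℕ) : ℝ) := by
      rw [Real.sqrt_le_left (by linarith)]
      nlinarith
    calc (1 : ℝ) / ((k + (N' + 1) : ℕ) : ℝ) ≤ 4 / ((k + (N' + 1) : ℕ) : ℝ) := by gcongr; norm_num
      _ ≤ 4 / Real.sqrt ((k + (N' + 1) : ℕ) : ℝ) :=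
          div_le_div_of_nonneg_left (by norm_num) (Real.sqrt_pos.2 hk0) hs
  have hs' : Summable fun k : ℕ => (1 : ℝ) / ((k + (N' + 1) : ℕ) : ℝ) :=
    Summable.of_nonneg_of_le (fun k => by positivity) hK ((summable_nat_add_iff (N' + 1)).2 hsum)
  have : Summable fun k : ℕ => (1 : ℝ) / (k : ℝ) := (summable_nat_add_iff (N' + 1)).1 hs'
  exact Real.not_summable_one_div_natCast this
/-! ### §3 The generating-function bound -/

/-- Summability of the generating-function series (terms in `[0, (1−γ)^s]`). -/
theorem summable_gf (ha : ∀ k, a k = if k ≤ N then 1 else if k ≤ N' then 4 / Real.sqrt N' else 4 / Real.sqrt k) (hN' : 16 ≤ N') {γ : ℝ} (h0 : 0 < γ) (h1 : γ < 1) :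
    Summable fun s : ℕ => (1 - γ) ^ s * a (s + 1) := by
  refine Summable.of_nonneg_of_le (fun s => mul_nonneg (pow_nonneg (by linarith) s) (seqA_pos ha hN' _).le)
    (fun s => ?_) (summable_geometric_of_lt_one (by linarith) (by linarith : 1 - γ < 1))
  exact mul_le_of_le_one_right (pow_nonneg (by linarith) s) (seqA_le_one ha hN' _)

/-- **Plateau regime**: `γ·Σ_s (1−γ)^s a_{s+1} ≥ 1 − (1−γ)^N ≥ Nγ/(1+Nγ)`. -/
theorem gf_ge_plateau (ha : ∀ k, a k = if k ≤ N then 1 else if k ≤ N' then 4 / Real.sqrt N' else 4 / Real.sqrt k) (hN' : 16 ≤ N') {γ : ℝ} (h0 : 0 < γ) (h1 : γ < 1) :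
    (N : ℝ) * γ / (1 + N * γ) ≤ γ * ∑' s : ℕ, (1 - γ) ^ s * a (s + 1) := by
  have hsum := summable_gf ha hN' h0 h1
  have hhead : ∑ s ∈ range N, (1 - γ) ^ s * a (s + 1) ≤ ∑' s : ℕ, (1 - γ) ^ s * a (s + 1) :=
    hsum.sum_le_tsum _ (fun s _ => mul_nonneg (pow_nonneg (by linarith) s) (seqA_pos ha hN' _).le)
  have hgeom : ∑ s ∈ range N, (1 - γ) ^ s * a (s + 1) = (1 - (1 - γ) ^ N) / γ := by
    have h1' : ∀ s ∈ range N, (1 - γ) ^ s * a (s + 1) = (1 - γ) ^ s := by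
      intro s hs
      rw [seqA_of_le_N ha (by rw [mem_range] at hs; omega), mul_one]
    rw [sum_congr rfl h1', eq_div_iff h0.ne']
    have h := geom_sum_mul_neg (1 - γ) N
    rwa [sub_sub_cancel] at h
  have hγ0 : γ ≠ 0 := h0.ne'
  have hpow := one_sub_pow_le_inv N h0.le h1.le
  have hpos : 0 < 1 + (N : ℝ) * γ := by positivity
  calc (N : ℝ) * γ / (1 + N * γ) = 1 - 1 / (1 + N * γ) := by field_simp; ring
    _ ≤ 1 - (1 - γ) ^ N := by linarith
    _ = γ * ((1 - (1 - γ) ^ N) / γ) := by field_simp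
    _ ≤ γ * ∑' s : ℕ, (1 - γ) ^ s * a (s + 1) := by
        rw [← hgeom]; exact mul_le_mul_of_nonneg_left hhead h0.le

/-- **Tail regime**: if `M = ⌊1/(2γ)⌋ ≥ 2N′` then `Σ_s (1−γ)^s a_{s+1} ≥ √M` (the block `N′ ≤ s < M` alone). -/
theorem gf_ge_tail (ha : ∀ k, a k = if k ≤ N then 1 else if k ≤ N' then 4 / Real.sqrt N' else 4 / Real.sqrt k) (hN' : 16 ≤ N') (hNN' : N ≤ N') {γ : ℝ} (h0 : 0 < γ) (h1 : γ < 1)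
    {M : ℕ} (hMγ : (M : ℝ) * γ ≤ 1 / 2) (hM : 2 * N' ≤ M) :
    Real.sqrt M ≤ ∑' s : ℕ, (1 - γ) ^ s * a (s + 1) := by
  have hsum := summable_gf ha hN' h0 h1
  have hM0 : (0 : ℝ) < M := by exact_mod_cast (show 0 < M by omega)
  have hblock : ∑ s ∈ Ico N' M, (1 - γ) ^ s * a (s + 1) ≤ ∑' s : ℕ, (1 - γ) ^ s * a (s + 1) :=
    hsum.sum_le_tsum _ (fun s _ => mul_nonneg (pow_nonneg (by linarith) s) (seqA_pos ha hN' _).le)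
  -- each term of the block is at least `(1/2)·(4/√M)`
  have hterm : ∀ s ∈ Ico N' M, (1 / 2) * (4 / Real.sqrt M) ≤ (1 - γ) ^ s * a (s + 1) := by
    intro s hs
    rw [mem_Ico] at hs
    have hs1 : N' < s + 1 := by omega
    rw [seqA_of_gt ha hNN' hs1]
    have hpow : 1 / 2 ≤ (1 - γ) ^ s := by
      refine (half_le_one_sub_pow M h1.le hMγ).trans ?_
      exact pow_le_pow_of_le_one (by linarith) (by linarith) hs.2.le
    have hsq : Real.sqrt ((s + 1 : ℕ) : ℝ) ≤ Real.sqrt M := Real.sqrt_le_sqrt (by exact_mod_cast hs.2)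
    have hs0 : 0 < Real.sqrt ((s + 1 : ℕ) : ℝ) := Real.sqrt_pos.2 (by exact_mod_cast (show 0 < s + 1 by omega))
    calc (1 / 2 : ℝ) * (4 / Real.sqrt M) ≤ (1 - γ) ^ s * (4 / Real.sqrt M) :=
          mul_le_mul_of_nonneg_right hpow (by positivity)
      _ ≤ (1 - γ) ^ s * (4 / Real.sqrt ((s + 1 : ℕ) : ℝ)) := by
          gcongr
  have hcard : ((Ico N' M).card : ℝ) = (M : ℝ) - N' := by
    rw [Nat.card_Ico]; push_cast [Nat.cast_sub (show N' ≤ M by omega)]; ring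
  have hsumblock : ((M : ℝ) - N') * ((1 / 2) * (4 / Real.sqrt M)) ≤ ∑ s ∈ Ico N' M, (1 - γ) ^ s * a (s + 1) := by
    rw [← hcard, ← nsmul_eq_mul]
    exact card_nsmul_le_sum _ _ _ hterm
  -- `(M − N')·2/√M ≥ (M/2)·2/√M = √M`
  have hMN : (M : ℝ) / 2 ≤ (M : ℝ) - N' := by
    have : (2 * N' : ℕ) ≤ M := hM
    have : (2 : ℝ) * N' ≤ M := by exact_mod_cast this
    linarith
  calc Real.sqrt M = (M : ℝ) / 2 * ((1 / 2) * (4 / Real.sqrt M)) := by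
        rw [show (M : ℝ) / 2 * ((1 / 2) * (4 / Real.sqrt M)) = (M : ℝ) / Real.sqrt M by ring, Real.div_sqrt]
    _ ≤ ((M : ℝ) - N') * ((1 / 2) * (4 / Real.sqrt M)) := mul_le_mul_of_nonneg_right hMN (by positivity)
    _ ≤ _ := hsumblock.trans hblock

/-- **The generating-function bound** for the witness: if `c_M ≤ 1/2`, `2 ≤ N` and `N² ≥ 4N′ + 2` (with `16 ≤ N′`, `N ≤ N′`) then
`c_M √γ ≤ γ·Σ_s (1−γ)^s a_{s+1}` for every `γ ∈ (0,1)`. -/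
theorem gf_bound (ha : ∀ k, a k = if k ≤ N then 1 else if k ≤ N' then 4 / Real.sqrt N' else 4 / Real.sqrt k) (hN' : 16 ≤ N') (hNN' : N ≤ N') (hN2 : 2 ≤ N) (hsq : 4 * N' + 2 ≤ N ^ 2)
    {cM : ℝ} (hcM : cM ≤ 1 / 2) {γ : ℝ} (h0 : 0 < γ) (h1 : γ < 1) :
    cM * Real.sqrt γ ≤ γ * ∑' s : ℕ, (1 - γ) ^ s * a (s + 1) := by
  have hsγ1 : Real.sqrt γ ≤ 1 := Real.sqrt_le_one.mpr h1.le |>.trans le_rfl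
  have hsγ0 : 0 ≤ Real.sqrt γ := Real.sqrt_nonneg γ
  have hN0 : (0 : ℝ) < N := by exact_mod_cast (show 0 < N by omega)
  -- trivial when `c_M ≤ 0`
  have hL0 : 0 ≤ γ * ∑' s : ℕ, (1 - γ) ^ s * a (s + 1) :=
    mul_nonneg h0.le (tsum_nonneg fun s => mul_nonneg (pow_nonneg (by linarith) s) (seqA_pos ha hN' _).le)
  by_cases hc : cM ≤ 0
  · exact le_trans (mul_nonpos_of_nonpos_of_nonneg hc hsγ0) hL0
  rw [not_le] at hc
  by_cases hreg : 4 * cM ^ 2 ≤ γ * N ^ 2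
  · -- plateau regime
    refine le_trans ?_ (gf_ge_plateau ha hN' h0 h1)
    have hpos : 0 < 1 + (N : ℝ) * γ := by positivity
    rw [le_div_iff₀ hpos]
    by_cases hNγ : 1 ≤ (N : ℝ) * γ
    · -- `Nγ/(1+Nγ) ≥ 1/2 ≥ c_M ≥ c_M √γ`
      have hc2 : cM * Real.sqrt γ ≤ 1 / 2 :=
        calc cM * Real.sqrt γ ≤ cM * 1 := mul_le_mul_of_nonneg_left hsγ1 hc.le
          _ ≤ 1 / 2 := by linarith
      calc cM * Real.sqrt γ * (1 + N * γ) ≤ 1 / 2 * (1 + N * γ) := mul_le_mul_of_nonneg_right hc2 hpos.le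
        _ ≤ N * γ := by linarith
    · -- `Nγ/(1+Nγ) ≥ Nγ/2 ≥ c_M √γ` since `√γ N ≥ 2 c_M`
      rw [not_le] at hNγ
      have hsq2 : (2 * cM) ^ 2 ≤ (Real.sqrt γ * N) ^ 2 := by
        rw [mul_pow, mul_pow, Real.sq_sqrt h0.le]; linarith
      have hkey : 2 * cM ≤ Real.sqrt γ * N :=
        calc 2 * cM = Real.sqrt ((2 * cM) ^ 2) := (Real.sqrt_sq (by positivity)).symm
          _ ≤ Real.sqrt ((Real.sqrt γ * N) ^ 2) := Real.sqrt_le_sqrt hsq2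
          _ = Real.sqrt γ * N := Real.sqrt_sq (by positivity)
      calc cM * Real.sqrt γ * (1 + N * γ) ≤ cM * Real.sqrt γ * 2 :=
            mul_le_mul_of_nonneg_left (by linarith) (mul_nonneg hc.le hsγ0)
        _ = (2 * cM) * Real.sqrt γ := by ring
        _ ≤ (Real.sqrt γ * N) * Real.sqrt γ := mul_le_mul_of_nonneg_right hkey hsγ0
        _ = N * γ := by rw [mul_comm (Real.sqrt γ) (N : ℝ), mul_assoc, Real.mul_self_sqrt h0.le]
  · -- tail regime: `γ < 4c_M²/N² ≤ 1/N²`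
    rw [not_le] at hreg
    have hcM2 : 4 * cM ^ 2 ≤ 1 := by nlinarith
    have hγN : γ * N ^ 2 < 1 := by linarith
    set M : ℕ := ⌊1 / (2 * γ)⌋₊ with hMdef
    have hMle : (M : ℝ) ≤ 1 / (2 * γ) := Nat.floor_le (by positivity)
    have hMgt : 1 / (2 * γ) - 1 < (M : ℝ) := by
      have := Nat.lt_floor_add_one (1 / (2 * γ)); linarith
    have hMγ : (M : ℝ) * γ ≤ 1 / 2 := by
      calc (M : ℝ) * γ ≤ 1 / (2 * γ) * γ := mul_le_mul_of_nonneg_right hMle h0.le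
        _ = 1 / 2 := by field_simp
    have h2γ : (1 : ℝ) / (2 * γ) = (1 / γ) / 2 := by field_simp
    -- `N² ≥ 4N'+2` and `γN² < 1` give `1/(2γ) > N²/2 ≥ 2N'+1`, so `M ≥ 2N'`
    have hM2 : 2 * N' ≤ M := by
      have hsq' : (4 * N' + 2 : ℝ) ≤ (N : ℝ) ^ 2 := by exact_mod_cast hsq
      have h1g : (N : ℝ) ^ 2 < 1 / γ := by rw [lt_div_iff₀ h0]; linarith
      have : (2 * N' : ℝ) < M := by rw [h2γ] at hMgt; linarith
      exact_mod_cast this.le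
    have htail := gf_ge_tail ha hN' hNN' h0 h1 hMγ hM2
    -- `γ √M = √γ · √(γ M) ≥ √γ / 2 ≥ c_M √γ`
    have hN2' : (2 : ℝ) ≤ N := by exact_mod_cast hN2
    have hN4 : (4 : ℝ) ≤ (N : ℝ) ^ 2 := by nlinarith
    have hγ4 : γ ≤ 1 / 4 := by nlinarith
    have hγM' : 1 / 2 - γ < γ * M := by
      have := mul_lt_mul_of_pos_left hMgt h0
      rwa [mul_sub, mul_one, show γ * (1 / (2 * γ)) = 1 / 2 by field_simp] at this
    have hγM : 1 / 4 ≤ γ * M := by linarith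
    have hsqrt : 1 / 2 ≤ Real.sqrt (γ * M) := by
      rw [show (1 / 2 : ℝ) = Real.sqrt (1 / 4) by
        rw [show (1 / 4 : ℝ) = (1 / 2) ^ 2 by norm_num, Real.sqrt_sq (by norm_num)]]
      exact Real.sqrt_le_sqrt hγM
    calc cM * Real.sqrt γ ≤ (1 / 2) * Real.sqrt γ := mul_le_mul_of_nonneg_right hcM hsγ0
      _ ≤ Real.sqrt (γ * M) * Real.sqrt γ := mul_le_mul_of_nonneg_right hsqrt hsγ0
      _ = γ * Real.sqrt M := by
          rw [Real.sqrt_mul h0.le, mul_comm, ← mul_assoc, Real.mul_self_sqrt h0.le]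
      _ ≤ γ * ∑' s : ℕ, (1 - γ) ^ s * a (s + 1) := mul_le_mul_of_nonneg_left htail h0.le
/-! ### §4 The product bound -/

/-- **The product bound** for the witness: `c_P ≤ a_n · Σ_{k=1}^n a_k` for all `n ≥ 1`, whenever `c_P ≤ 1`, `16 ≤ N′`, `N ≤ N′`,
`N′ ≤ 16 N²`. -/
theorem product_bound (ha : ∀ k, a k = if k ≤ N then 1 else if k ≤ N' then 4 / Real.sqrt N' else 4 / Real.sqrt k) (hN' : 16 ≤ N') (hNN' : N ≤ N') (hN'le : N' ≤ 16 * N ^ 2)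
    {cP : ℝ} (hcP : cP ≤ 1) {n : ℕ} (hn : 1 ≤ n) :
    cP ≤ a n * ∑ k ∈ Icc 1 n, a k := by
  have hpos := fun k => (seqA_pos ha hN' k).le
  have hN'0 : (0 : ℝ) < N' := by exact_mod_cast (show 0 < N' by omega)
  have hsN' : 0 < Real.sqrt N' := Real.sqrt_pos.2 hN'0
  by_cases h1 : n ≤ N
  · -- `a_n = 1`, and the `k = 1` term alone gives `1`
    rw [seqA_of_le_N ha h1, one_mul]
    refine hcP.trans ?_
    have h1mem : 1 ∈ Icc 1 n := by rw [mem_Icc]; omega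
    have := single_le_sum (f := a) (fun k _ => hpos k) h1mem
    rwa [seqA_of_le_N ha (show 1 ≤ N by omega)] at this
  by_cases h2 : n ≤ N'
  · -- `a_n = 4/√N'`, the plateau `k ≤ N` contributes `N`
    rw [seqA_of_mid ha (not_le.1 h1) h2]
    have hsub : Icc 1 N ⊆ Icc 1 n := Icc_subset_Icc le_rfl (not_le.1 h1).le
    have hS : (N : ℝ) ≤ ∑ k ∈ Icc 1 n, a k := by
      calc (N : ℝ) = ∑ k ∈ Icc 1 N, (1 : ℝ) := by simp
        _ = ∑ k ∈ Icc 1 N, a k := sum_congr rfl fun k hk => (seqA_of_le_N ha (mem_Icc.1 hk).2).symm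
        _ ≤ _ := sum_le_sum_of_subset_of_nonneg hsub fun k _ _ => hpos k
    -- `4N/√N' ≥ 1 ≥ c_P` since `16 N² ≥ N'`
    have hkey : 1 ≤ 4 / Real.sqrt N' * N := by
      rw [div_mul_eq_mul_div, le_div_iff₀ hsN', one_mul]
      have h16 : (N' : ℝ) ≤ 16 * N ^ 2 := by exact_mod_cast hN'le
      calc Real.sqrt N' ≤ Real.sqrt (16 * N ^ 2) := Real.sqrt_le_sqrt h16
        _ = 4 * N := by
            rw [show (16 : ℝ) * N ^ 2 = (4 * N) ^ 2 by ring, Real.sqrt_sq (by positivity)]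
    calc cP ≤ 1 := hcP
      _ ≤ 4 / Real.sqrt N' * N := hkey
      _ ≤ 4 / Real.sqrt N' * ∑ k ∈ Icc 1 n, a k := mul_le_mul_of_nonneg_left hS (by positivity)
  · -- `a_n = 4/√n`; plateau mass `N'·4/√N'` plus `(n − N')·4/√n`
    rw [not_le] at h2
    rw [seqA_of_gt ha hNN' h2]
    have hn0 : (0 : ℝ) < n := by exact_mod_cast (show 0 < n by omega)
    have hsn : 0 < Real.sqrt n := Real.sqrt_pos.2 hn0
    have hsplit : ∑ k ∈ Icc 1 n, a k = ∑ k ∈ Icc 1 N', a k + ∑ k ∈ Icc (N' + 1) n, a k := by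
      rw [← sum_union]
      · congr 1
        ext k; simp only [mem_union, mem_Icc]; omega
      · rw [disjoint_left]; intro k hk hk'; rw [mem_Icc] at hk hk'; omega
    have hA : (N' : ℝ) * (4 / Real.sqrt N') ≤ ∑ k ∈ Icc 1 N', a k := by
      calc (N' : ℝ) * (4 / Real.sqrt N') = ∑ k ∈ Icc 1 N', (4 / Real.sqrt N' : ℝ) := by simp
        _ ≤ _ := sum_le_sum fun k hk => height_le_seqA ha hN' (mem_Icc.1 hk).2
    have hB : ((n : ℝ) - N') * (4 / Real.sqrt n) ≤ ∑ k ∈ Icc (N' + 1) n, a k := by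
      have hcard : ((Icc (N' + 1) n).card : ℝ) = (n : ℝ) - N' := by
        rw [Nat.card_Icc]; push_cast [Nat.cast_sub (show N' ≤ n by omega)]; ring
      rw [← hcard, ← nsmul_eq_mul]
      refine card_nsmul_le_sum _ _ _ fun k hk => ?_
      rw [mem_Icc] at hk
      rw [seqA_of_gt ha hNN' (by omega)]
      exact div_le_div_of_nonneg_left (by norm_num) (Real.sqrt_pos.2 (by exact_mod_cast (show 0 < k by omega)))
        (Real.sqrt_le_sqrt (by exact_mod_cast hk.2))
    -- `(4/√n)·[N'·4/√N' + (n−N')·4/√n] = 16·[u + 1 − u²] ≥ 16`, `u = √N'/√n ∈ [0,1]`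
    set u : ℝ := Real.sqrt N' / Real.sqrt n with hu
    have hu0 : 0 ≤ u := by positivity
    have hu1 : u ≤ 1 := by
      rw [hu, div_le_one hsn]
      exact Real.sqrt_le_sqrt (by exact_mod_cast h2.le)
    have e1 : (N' : ℝ) * (4 / Real.sqrt N') = 4 * Real.sqrt N' := by
      rw [mul_div_assoc', div_eq_iff hsN'.ne', mul_assoc, Real.mul_self_sqrt hN'0.le, mul_comm]
    have e2 : 4 / Real.sqrt n * (((n : ℝ) - N') * (4 / Real.sqrt n)) = 16 * ((n : ℝ) - N') / (Real.sqrt n * Real.sqrt n) := by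
      field_simp; ring
    have e3 : 16 * ((n : ℝ) - N') / (Real.sqrt n * Real.sqrt n) = 16 * (1 - u ^ 2) := by
      rw [Real.mul_self_sqrt hn0.le, hu, div_pow, Real.sq_sqrt hN'0.le, Real.sq_sqrt hn0.le]
      field_simp
    have hmain : 16 ≤ 4 / Real.sqrt n * ((N' : ℝ) * (4 / Real.sqrt N') + ((n : ℝ) - N') * (4 / Real.sqrt n)) := by
      rw [mul_add, e2, e3, e1, show 4 / Real.sqrt n * (4 * Real.sqrt N') = 16 * u by rw [hu]; ring]
      nlinarith [mul_le_mul_of_nonneg_left hu1 hu0]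
    calc cP ≤ 1 := hcP
      _ ≤ 16 := by norm_num
      _ ≤ 4 / Real.sqrt n * ((N' : ℝ) * (4 / Real.sqrt N') + ((n : ℝ) - N') * (4 / Real.sqrt n)) := hmain
      _ ≤ 4 / Real.sqrt n * ∑ k ∈ Icc 1 n, a k := by
          rw [hsplit]; exact mul_le_mul_of_nonneg_left (add_le_add hA hB) (by positivity)

end Summit.CriticalPhenomena.PercolationContinuityZ3.Theorems.CritVolumeNoGo

end
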